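import Literature.AnabelianGeometry.EtaleTheta.Discharge.Sec3Thm37RatStdOfLine
import Literature.AnabelianGeometry.EtaleTheta.TemperedFrobenioidCnst
import Mathlib.GroupTheory.OrderOfElement
import HarnessLib

/-!
# [EtTh] Theorem 3.7 (ii), second clause: the input "`Π^tp_X` acts trivially on `K^×/O_K^×`" DERIVED from
# Proposition 3.4 (ii) relative to `D^cnst` (naturality of constants) and the finiteness of `Aut_{D^cnst}`

S. Mochizuki, *The étale theta function and its Frobenioid-theoretic manifestations*, Publ. RIMS **45**
(2009) [EtTh], §3: Prop. 3.4 (ii) PDF p. 74, Def. 3.6 (i)/(ii) PDF pp. 76–77, Thm. 3.7 (ii)/(iii) PDF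
pp. 79–80 (printed pp. 300–306) of `paper:doi-10-2977-prims-1234361159`
[cite: MochizukiEtTh2009, Thm 3.7 (ii) p.79] [cite: MochizukiEtTh2009, Prop 3.4 (ii) p.74]:

> (proof of Thm. 3.7 (ii), p. 80) "since `Π^tp_X` acts trivially on `K^×/O_K^×`, it follows [cf. also the
> condition imposed on `F` in Definition 3.6, (ii), (b)] that every object of `(C^un-tr)^birat` is
> Frobenius-compact."

Proof-only sequel (theorems only, no definitions; cell abc-iut, layer L2, node `EtTh:Thm3.7(ii)`, seat
abc-iut-w5-d250 gen 3; GAP-LEDGER row G-w5d250-1) of `Discharge/Sec3Thm37RatStdOfLine.lean`, which derived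
the binder `hKfix` of `thm37_ii_ratStd_treeCatVocab` ("pull-backs along automorphisms of `A` fix the divisors
of constant rational functions") for `ℤ`-MONOPRIME `Φ^{bs-fld}(A)`.  Here `hKfix` is derived for `Φ^{bs-fld}(A)`
monoprime of ANY type (`ℤ`, `ℚ` or `ℝ` — all three monoid types `Λ` of Def. 3.6 (i)) along print's own route,
from typed interface data only:

* abc-iut-L2-t3's hypothesis structure `RealifiedDivisorMonoids.Prop34Cnst T cnst`
  (`TemperedFrobenioidCnst.lean`): Prop. 3.4 (ii) relative to the constant-field functor
  `cnst : D₀ ⥤ D^cnst` — the pull-back action of `D₀`-morphisms on the (effective) log-divisors of CONSTANTS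
  depends only on their images in `D^cnst` (`ΦR_map_eq_of_cnst_map_eq`), and the effective locus of `B₀^Λ`
  consists of constants (`mem_FΛ_of_divΛ_eq_of`);
* `hfin` — the image of `f ∈ Aut_D(A)` in `Aut_{D^cnst}(A^cnst)` has FINITE ORDER (print: `D^cnst = B(Spec K)⁰`,
  `A^cnst = Spec L`, `Aut_{D^cnst}(A^cnst) = Aut(L/K)` is a finite group; an interface-genre property of the
  datum `D^cnst`, supplied at the merge `D^cnst := B(G_K)⁰`, TODO-merge(abc-iut-L3-t2 / abc-iut-L1-t4));
* `hLine`, `hInt` — the constant line `ℝ·Φ₀^cnst(Y)` consists of effective and anti-effective elements and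
  `Φ₀^ℝ(Y)` is integral (binders of GAP row G-w5d124-2, VERBATIM as in `Sec3Def36NonzeroConstants.lean`).

The argument: the divisor `r` of a constant is acted on through the finite-order image of `f` in
`Aut_{D^cnst}(A^cnst)` (`Prop34Cnst`), so some ITERATE `Φ(f)ⁿ`, `n ≥ 1`, fixes `r`
(`iterate_pull_eq_self_of_prop34Cnst`); but `Φ(f)` restricts to an automorphism of the monoprime — hence
totally ordered by divisibility — monoid `Φ^{bs-fld}(A) ∋ r`, and an element with a finite orbit under an
order-automorphism of a total order is FIXED (`apply_eq_self_of_dvd_total_of_iterate_apply_eq`: if `r ≤ σ r`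
then `σ r ≤ σ² r ≤ ⋯ ≤ σⁿ r = r`); so `Φ(f) r = r` (`pull_eq_self_of_prop34Cnst_of_isOfFinOrder`) — this IS
"the action on `K^×/O_K^× ≅ ℤ` (valuations of constants) is trivial".  Then `pullGp_cnst_eq_self_of_line_of_cnst`
(= `hKfix`) as in the `ℤ`-monoprime file, and **`thm37_ii_ratStd_treeCatVocab_of_cnst(')`**: [EtTh] Thm. 3.7
(ii), second clause, at the canonical vocabulary and THE [FrdI] Def. 4.5 parameters, modulo
`hBmon`/`hD`/`hnd`/`hrat` (as before), `Prop34Cnst`, `hfin`, `hLine`, `hInt` — NO automorphism-invariance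
datum.  HONEST FRAMING: refereed pre-IUT material ([EtTh] §3 over [FrdI] §4–§5); nothing here bears on
[IUTchIII] Cor. 3.12; no statement of either paper is strengthened; typed ≠ proved — here PROVED modulo the
named inputs.
-/

namespace Literature.AnabelianGeometry.EtaleTheta

open CategoryTheory Opposite Literature.AlgebraicGeometry.Frobenioids

universe u₀ v₀ u₁ v₁ u v w

/-! ### §0 Folklore: finite orbits of an endomorphism of a monoid totally ordered by divisibility -/

section Folklore

variable {M : Type*} [CommMonoid M]

/-- Every element of `M^gp` is a fraction `x/y` of elements of `M`. [folklore] -/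
private theorem gp_exists_eq_div (ξ : Algebra.GrothendieckGroup M) :
    ∃ x y : M, ξ = Algebra.GrothendieckGroup.of x / Algebra.GrothendieckGroup.of y := by
  obtain ⟨⟨x, y⟩, h⟩ := (Localization.monoidOf (⊤ : Submonoid M)).surj ξ
  exact ⟨x, y, eq_div_iff_mul_eq'.mpr h⟩

/-- In an integral monoid, `r = x/y` in `M^gp` forces `x = r·y`. [folklore] -/
private theorem eq_mul_of_of_eq_div (hM : IsCancelMul M) {x y r : M}
    (h : Algebra.GrothendieckGroup.of r = Algebra.GrothendieckGroup.of x / Algebra.GrothendieckGroup.of y) :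
    x = r * y := by
  haveI := hM
  apply Algebra.GrothendieckGroup.of_injective
  rw [map_mul, h, div_mul_cancel]

/-- In an integral monoid, `r⁻¹ = x/y` in `M^gp` forces `y = r·x`. [folklore] -/
private theorem eq_mul_of_of_inv_eq_div (hM : IsCancelMul M) {x y r : M}
    (h : (Algebra.GrothendieckGroup.of r)⁻¹ = Algebra.GrothendieckGroup.of x / Algebra.GrothendieckGroup.of y) :
    y = r * x := by
  haveI := hM
  apply Algebra.GrothendieckGroup.of_injective
  rw [map_mul, ← inv_inv (Algebra.GrothendieckGroup.of r), h, inv_div, div_mul_cancel]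

/-- **An element with a finite orbit under an endomorphism of a monoid totally ordered by divisibility is
fixed** (pointwise form of `apply_eq_self_of_dvd_total_of_iterate_eq`; the monoprime monoids
`ℤ_{≥0}, ℚ_{≥0}, ℝ_{≥0}` of [FrdI] §0 p. 10 are totally ordered by `≤`): if `σⁿ(x) = x` for some `n ≥ 1` then
`σ(x) = x` — for `x ≤ σ(x)` gives `σ(x) ≤ σ²(x) ≤ ⋯ ≤ σⁿ(x) = x`, and symmetrically.
[cite: MochizukiFrdI2008, §0 p.10] -/
theorem apply_eq_self_of_dvd_total_of_iterate_apply_eq {N : Type*} [CommMonoid N]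
    (htot : ∀ a b : N, a ∣ b ∨ b ∣ a) (hanti : ∀ {a b : N}, a ∣ b → b ∣ a → a = b)
    (σ : N →* N) {n : ℕ} (hn : 0 < n) {x : N} (hσ : σ^[n] x = x) : σ x = x := by
  have hiter : ∀ (k : ℕ) {a b : N}, a ∣ b → σ^[k] a ∣ σ^[k] b := by
    intro k
    induction k with
    | zero => intro a b h; exact h
    | succ k ih =>
      intro a b h
      rw [Function.iterate_succ_apply', Function.iterate_succ_apply']
      exact map_dvd σ (ih h)
  obtain ⟨m, rfl⟩ := Nat.exists_eq_add_one_of_ne_zero hn.ne'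
  rcases htot x (σ x) with h | h
  · have hchain : ∀ k : ℕ, σ x ∣ σ^[k + 1] x := by
      intro k
      induction k with
      | zero => exact dvd_rfl
      | succ k ih =>
        have h' := hiter (k + 1) h
        rw [← Function.iterate_succ_apply σ (k + 1) x] at h'
        exact dvd_trans ih h'
    have hx : σ x ∣ x := by
      have h' := hchain m
      rwa [hσ] at h'
    exact hanti hx h
  · have hchain : ∀ k : ℕ, σ^[k + 1] x ∣ σ x := by
      intro k
      induction k with
      | zero => exact dvd_rfl
      | succ k ih =>
        have h' := hiter (k + 1) h
        rw [← Function.iterate_succ_apply σ (k + 1) x] at h'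
        exact dvd_trans h' ih
    have hx : x ∣ σ x := by
      have h' := hchain m
      rwa [hσ] at h'
    exact (hanti hx h).symm

/-- `Functor.mapAut` (the group homomorphism `Aut(x) → Aut(F x)` induced by a functor) is `Functor.mapIso`.
[folklore] -/
private theorem mapAut_eq_mapIso {X : Type*} [Category X] {X' : Type*} [Category X'] (F : X ⥤ X') {x : X}
    (ψ : Aut x) : F.mapAut x ψ = F.mapIso ψ := rfl

end Folklore

variable {D₀ : Type u₀} [Category.{v₀} D₀] {V : FrdIMonoidStub.{w}}
  {T : RealifiedDivisorMonoids (D₀ := D₀) V} {Dcnst : Type u₁} [Category.{v₁} Dcnst] {cnst : D₀ ⥤ Dcnst}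
  {D : Type u} [Category.{v} D]

namespace TemperedFrobenioid

section General

variable {VD : FrdICatStub.{u, v, w} D} (C : TemperedFrobenioid T D VD)

/-! ### §1 Iterated pull-backs along an automorphism are pull-backs along its powers -/

/-- The `k`-th iterate of the pull-back `Φ^{ℝ-log}(f) = Φ₀^ℝ(f_{D₀})` along an automorphism `f` of `A ∈ Ob(D)` is
the pull-back along the `k`-th power of the automorphism `f_{D₀}` of `Y_A` in `D₀` (functoriality of
`Φ₀^ℝ`). [cite: MochizukiEtTh2009, Def 3.6 p.76] -/
theorem iterate_ΦRlog_map_eq_map_pow (A : D) (f : A ≅ A) (k : ℕ) (x : C.ΦRlog.obj (op A)) :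
    ((C.ΦRlog.map f.hom.op).hom)^[k] x = (T.ΦR.map ((C.base.mapAut A f) ^ k).hom.op).hom x := by
  induction k generalizing x with
  | zero =>
    rw [Function.iterate_zero_apply, pow_zero]
    change x = (T.ΦR.map (𝟙 (C.base.obj A)).op).hom x
    rw [op_id, T.ΦR.map_id]
    rfl
  | succ k ih =>
    rw [Function.iterate_succ_apply', ih, pow_succ, Aut.Aut_mul_def, Iso.trans_hom, mapAut_eq_mapIso,
      Functor.mapIso_hom, op_comp, T.ΦR.map_comp, CommMonCat.comp_apply]
    rfl

/-- If the image of `f ∈ Aut_D(A)` in `Aut_{D^cnst}(A^cnst)` has finite order, some power `f_{D₀}ⁿ`, `n ≥ 1`,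
of `f_{D₀} ∈ Aut_{D₀}(Y_A)` has TRIVIAL image in `Aut_{D^cnst}(A^cnst)`. [cite: MochizukiEtTh2009, Thm 3.7 (iii) p.79] -/
theorem exists_cnst_map_pow_eq_id (A : D) (f : A ≅ A)
    (hfin : IsOfFinOrder (cnst.mapAut _ (C.base.mapAut A f))) :
    ∃ n : ℕ, 0 < n ∧ cnst.map ((C.base.mapAut A f) ^ n).hom = cnst.map (𝟙 (C.base.obj A)) := by
  obtain ⟨n, hn, h1⟩ := hfin.exists_pow_eq_one
  refine ⟨n, hn, ?_⟩
  rw [← map_pow] at h1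
  have h3 := congrArg Iso.hom h1
  rw [mapAut_eq_mapIso, Functor.mapIso_hom] at h3
  rw [h3, cnst.map_id]
  rfl

/-! ### §2 `Prop34Cnst` + finite order in `Aut_{D^cnst}(A^cnst)` ⇒ divisors of constants are fixed -/

/-- **Some iterate of `Φ(f)` fixes the divisor of every constant** — Prop. 3.4 (ii) relative to `D^cnst`
(`Prop34Cnst.ΦR_map_eq_of_cnst_map_eq`: the pull-back action on log-divisors of constants factors through
`D₀ → D^cnst`) applied to a power `f_{D₀}ⁿ` with trivial image in `Aut_{D^cnst}(A^cnst)` (`hfin`).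
[cite: MochizukiEtTh2009, Prop 3.4 (ii) p.74] -/
theorem iterate_pull_eq_self_of_prop34Cnst (hP : T.Prop34Cnst cnst) (A : D) (f : A ≅ A)
    (hfin : IsOfFinOrder (cnst.mapAut _ (C.base.mapAut A f)))
    (r : C.ΦRlog.obj (op A))
    (hr : ∃ b ∈ T.FΛ (C.baseOp (op A)), T.divΛ _ b = Algebra.GrothendieckGroup.of r) :
    ∃ n : ℕ, 0 < n ∧ ((C.ΦRlog.map f.hom.op).hom)^[n] r = r := by
  obtain ⟨n, hn, hcn⟩ := C.exists_cnst_map_pow_eq_id A f hfin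
  refine ⟨n, hn, ?_⟩
  rw [C.iterate_ΦRlog_map_eq_map_pow A f n r, hP.ΦR_map_eq_of_cnst_map_eq _ _ hcn r hr, op_id, T.ΦR.map_id]
  rfl

/-- **The pull-back `Φ(f)`, `f ∈ Aut_D(A)`, FIXES the divisor of every constant** ("`Π^tp_X` acts trivially
on `K^×/O_K^×`", proof of Thm. 3.7 (ii), p. 80), for `Φ^{bs-fld}(A)` monoprime of any type (Def. 3.6 (ii)(a)):
the divisor `r ∈ Φ(A)` of a constant lies in `Φ^{bs-fld}(A)` (`divΛ_mem_cnstR`), which `Φ(f)` maps to itself by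
a monoid automorphism; `Φ^{bs-fld}(A) ≅ ℤ_{≥0}, ℚ_{≥0}` or `ℝ_{≥0}` is totally ordered by divisibility
(`IsMonoprime.dvd_total`, `monoprime_dvd_antisymm`), and `r` has a finite `Φ(f)`-orbit
(`iterate_pull_eq_self_of_prop34Cnst`), hence is fixed (`apply_eq_self_of_dvd_total_of_iterate_apply_eq`).
[cite: MochizukiEtTh2009, Thm 3.7 (ii) p.79] -/
theorem pull_eq_self_of_prop34Cnst_of_isOfFinOrder (hP : T.Prop34Cnst cnst) (A : D) (f : A ≅ A)
    (hfin : IsOfFinOrder (cnst.mapAut _ (C.base.mapAut A f)))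
    (r : C.Φ.carrier (op A))
    (hr : ∃ b ∈ T.FΛ (C.baseOp (op A)), T.divΛ _ b = Algebra.GrothendieckGroup.of (r : C.ΦRlog.obj (op A))) :
    C.Φ.pull f.hom.op r = r := by
  -- `r ∈ Φ^{bs-fld}(A)`
  have hrbs : (r : C.ΦRlog.obj (op A)) ∈ C.bsFld.carrier (op A) := by
    obtain ⟨b, hb, hdiv⟩ := hr
    exact ⟨r.2, show Algebra.GrothendieckGroup.of (r : C.ΦRlog.obj (op A)) ∈ T.cnstR (C.baseOp (op A)) from
      hdiv ▸ T.divΛ_mem_cnstR _ b hb⟩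
  -- iterates of the restricted pull-back `Φ^{bs-fld}(f)` are computed in `Φ^{ℝ-log}(A)`
  have hval : ∀ (k : ℕ) (y : C.bsFld.carrier (op A)),
      (((C.bsFld.pull f.hom.op)^[k] y : C.bsFld.carrier (op A)) : C.ΦRlog.obj (op A)) =
        ((C.ΦRlog.map f.hom.op).hom)^[k] (y : C.ΦRlog.obj (op A)) := by
    intro k
    induction k with
    | zero => intro y; rfl
    | succ k ih =>
      intro y
      rw [Function.iterate_succ_apply', Function.iterate_succ_apply', ← ih y]
      rfl
  -- a finite orbit
  obtain ⟨n, hn, hfix⟩ := C.iterate_pull_eq_self_of_prop34Cnst hP A f hfin r hr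
  have hper : (C.bsFld.pull f.hom.op)^[n] ⟨r, hrbs⟩ = ⟨r, hrbs⟩ := by
    apply Subtype.ext
    rw [hval n ⟨r, hrbs⟩]
    exact hfix
  -- total order on the monoprime `Φ^{bs-fld}(A)`
  have hmono : IsMonoprime (C.bsFld.carrier (op A)) := C.isMonoprime_bsFld (op A)
  have h := apply_eq_self_of_dvd_total_of_iterate_apply_eq hmono.dvd_total
    (fun h₁ h₂ => monoprime_dvd_antisymm hmono h₁ h₂) (C.bsFld.pull f.hom.op) hn hper
  have h' : ((C.bsFld.pull f.hom.op ⟨r, hrbs⟩ : C.bsFld.carrier (op A)) : C.ΦRlog.obj (op A)) = r :=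
    congrArg Subtype.val h
  exact Subtype.ext h'

/-! ### §3 `hKfix` from the constant line, `Prop34Cnst` and finiteness in `Aut_{D^cnst}` -/

/-- **Step 2 refined — the divisor of a constant rational function is fixed by every pull-back fixing the
EFFECTIVE divisors of constants.**  For `b ∈ F₀^Λ(Y_A)`, `(b, ξ) ∈ B(A)`: `ξ` lies on the constant line, so
(`hLine`, `hInt`, group-saturation of `Φ ⊆ Φ^{ℝ-log}`) `ξ = of(r)^{±1}` with `r ∈ Φ(A)` the EFFECTIVE divisor of a
constant — of `b` itself, resp. of `b⁻¹ ∈ B₀^Λ(Y_A)` (`isUnit_BΛ`), which is constant by Prop. 3.4 (ii)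
(`Prop34Cnst.mem_FΛ_of_divΛ_eq_of`: the effective locus of `B₀^Λ` consists of constants); hence a pull-back
fixing such `r` (`hfixc`) fixes `ξ`. [cite: MochizukiEtTh2009, Thm 3.7 (ii) p.79] -/
theorem pullGp_cnst_eq_self_of_line_of_fix_cnstDiv (hP : T.Prop34Cnst cnst) (A : D)
    (hLine : ∀ (Y : D₀ᵒᵖ) (g : Algebra.GrothendieckGroup (T.ΦR.obj Y)), g ∈ T.cnstR Y →
      ∃ r : T.ΦR.obj Y, g = Algebra.GrothendieckGroup.of r ∨ g = (Algebra.GrothendieckGroup.of r)⁻¹)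
    (hInt : ∀ Y : D₀ᵒᵖ, IsCancelMul (T.ΦR.obj Y)) (f : A ≅ A)
    (hfixc : ∀ r : C.Φ.carrier (op A),
      (∃ b ∈ T.FΛ (C.baseOp (op A)), T.divΛ _ b = Algebra.GrothendieckGroup.of (r : C.ΦRlog.obj (op A))) →
        C.Φ.pull f.hom.op r = r)
    (b : T.BΛ.obj (C.baseOp (op A))) (ξ : Algebra.GrothendieckGroup (C.Φ.carrier (op A)))
    (hb : b ∈ T.FΛ (C.baseOp (op A))) (hbξ : (b, ξ) ∈ C.ratFn (op A)) :
    pullGp C.divisorMonoid f.hom ξ = ξ := by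
  have hdiv : T.divΛ (C.baseOp (op A)) b = C.ΦgpToRlog (op A) ξ := hbξ
  have hmem : C.ΦgpToRlog (op A) ξ ∈ T.cnstR (C.baseOp (op A)) := hdiv ▸ T.divΛ_mem_cnstR _ b hb
  obtain ⟨x, y, rfl⟩ := gp_exists_eq_div ξ
  have hxy : C.ΦgpToRlog (op A) (Algebra.GrothendieckGroup.of x / Algebra.GrothendieckGroup.of y) =
      Algebra.GrothendieckGroup.of (x : C.ΦRlog.obj (op A)) /
        Algebra.GrothendieckGroup.of (y : C.ΦRlog.obj (op A)) := by
    rw [map_div, ΦgpToRlog, gpMap_of, gpMap_of]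
    rfl
  rw [hxy] at hmem hdiv
  obtain ⟨r, hr | hr⟩ := hLine _ _ hmem
  · -- effective case: `x = r·y`, `r = div(b)`, `ξ = of(r)`
    have hxry := eq_mul_of_of_eq_div (hInt (C.baseOp (op A))) hr.symm
    have hrΦ : r ∈ C.Φ.carrier (op A) :=
      (isGroupSaturated_iff' _).1 (C.isGroupSaturated (op A)) r x x.2 y y.2 hxry.symm
    have hrc : ∃ b' ∈ T.FΛ (C.baseOp (op A)), T.divΛ _ b' =
        Algebra.GrothendieckGroup.of (((⟨r, hrΦ⟩ : C.Φ.carrier (op A)) : C.ΦRlog.obj (op A))) :=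
      ⟨b, hb, hdiv.trans hr⟩
    have hx : x = ⟨r, hrΦ⟩ * y := Subtype.ext hxry
    subst hx
    have hξ : Algebra.GrothendieckGroup.of ((⟨r, hrΦ⟩ : C.Φ.carrier (op A)) * y) /
        Algebra.GrothendieckGroup.of y = Algebra.GrothendieckGroup.of (⟨r, hrΦ⟩ : C.Φ.carrier (op A)) := by
      rw [map_mul, mul_div_assoc, div_self', mul_one]
    rw [hξ]
    have h1 := pullGp_of (Φ := C.divisorMonoid) f.hom (⟨r, hrΦ⟩ : C.Φ.carrier (op A))
    have h2 := congrArg Algebra.GrothendieckGroup.of (hfixc ⟨r, hrΦ⟩ hrc)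
    exact h1.trans h2
  · -- anti-effective case: `y = r·x`, `r = div(b⁻¹)` with `b⁻¹` constant (Prop. 3.4 (ii)), `ξ = of(r)⁻¹`
    have hyrx := eq_mul_of_of_inv_eq_div (hInt (C.baseOp (op A))) hr.symm
    have hrΦ : r ∈ C.Φ.carrier (op A) :=
      (isGroupSaturated_iff' _).1 (C.isGroupSaturated (op A)) r y y.2 x x.2 hyrx.symm
    -- the inverse constant `b'` with `div(b') = r`
    obtain ⟨b', hb'⟩ := (T.isUnit_BΛ (C.baseOp (op A)) b).exists_left_inv
    have hdiv' : T.divΛ (C.baseOp (op A)) b' = Algebra.GrothendieckGroup.of r := by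
      have h1 : T.divΛ (C.baseOp (op A)) b' * T.divΛ (C.baseOp (op A)) b = 1 := by
        rw [← map_mul, hb', map_one]
      rw [eq_inv_of_mul_eq_one_left h1, hdiv, hr, inv_inv]
    have hrc : ∃ b' ∈ T.FΛ (C.baseOp (op A)), T.divΛ _ b' =
        Algebra.GrothendieckGroup.of (((⟨r, hrΦ⟩ : C.Φ.carrier (op A)) : C.ΦRlog.obj (op A))) :=
      ⟨b', hP.mem_FΛ_of_divΛ_eq_of _ b' r hdiv', hdiv'⟩
    have hy : y = ⟨r, hrΦ⟩ * x := Subtype.ext hyrx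
    subst hy
    have hξ : Algebra.GrothendieckGroup.of x /
        Algebra.GrothendieckGroup.of ((⟨r, hrΦ⟩ : C.Φ.carrier (op A)) * x) =
          (Algebra.GrothendieckGroup.of (⟨r, hrΦ⟩ : C.Φ.carrier (op A)))⁻¹ := by
      rw [map_mul, div_mul_eq_div_div_swap, div_self', one_div]
    rw [hξ]
    have h1 := pullGp_of (Φ := C.divisorMonoid) f.hom (⟨r, hrΦ⟩ : C.Φ.carrier (op A))
    have h2 := congrArg Algebra.GrothendieckGroup.of (hfixc ⟨r, hrΦ⟩ hrc)
    exact (map_inv (pullGp C.divisorMonoid f.hom) _).trans (congrArg Inv.inv (h1.trans h2))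

/-- **`hKfix` DERIVED for every monoid type** — print's "since `Π^tp_X` acts trivially on `K^×/O_K^×`" (Thm. 3.7
(ii), proof, p. 80) as a theorem over the typed interface: the pull-back along every automorphism `f` of `A`
whose image in `Aut_{D^cnst}(A^cnst)` has finite order fixes the divisor of every constant rational function,
given Prop. 3.4 (ii) relative to `D^cnst` (`Prop34Cnst`) and the constant-line properties `hLine`, `hInt`.
[cite: MochizukiEtTh2009, Thm 3.7 (ii) p.79] -/
theorem pullGp_cnst_eq_self_of_line_of_cnst (hP : T.Prop34Cnst cnst) (A : D)
    (hLine : ∀ (Y : D₀ᵒᵖ) (g : Algebra.GrothendieckGroup (T.ΦR.obj Y)), g ∈ T.cnstR Y →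
      ∃ r : T.ΦR.obj Y, g = Algebra.GrothendieckGroup.of r ∨ g = (Algebra.GrothendieckGroup.of r)⁻¹)
    (hInt : ∀ Y : D₀ᵒᵖ, IsCancelMul (T.ΦR.obj Y)) (f : A ≅ A)
    (hfin : IsOfFinOrder (cnst.mapAut _ (C.base.mapAut A f)))
    (b : T.BΛ.obj (C.baseOp (op A))) (ξ : Algebra.GrothendieckGroup (C.Φ.carrier (op A)))
    (hb : b ∈ T.FΛ (C.baseOp (op A))) (hbξ : (b, ξ) ∈ C.ratFn (op A)) :
    pullGp C.divisorMonoid f.hom ξ = ξ :=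
  C.pullGp_cnst_eq_self_of_line_of_fix_cnstDiv hP A hLine hInt f
    (C.pull_eq_self_of_prop34Cnst_of_isOfFinOrder hP A f hfin) b ξ hb hbξ

end General

/-! ### §4 Theorem 3.7 (ii), second clause, with `hKfix` discharged for every monoid type -/

section TreeVocab

variable {IsRational IsStrictlyRational : (Dᵒᵖ ⥤ CommMonCat.{w}) → Prop}
  (C₀ : TemperedFrobenioid T D (treeCatVocab D IsRational IsStrictlyRational))

/-- **"Every object of `(C^un-tr)^birat` is Frobenius-compact" — the instance print uses, from typed data**:
at `A ∈ Ob(D)` with `Aut_{D^cnst}(A^cnst)` of finite exponent on the image of `Aut_D(A)` (`hfin`), given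
`Prop34Cnst`, `hLine`, `hInt`. [cite: MochizukiEtTh2009, Thm 3.7 (ii) p.79] -/
theorem exists_isFrobeniusCompact_untrBirat_treeCatVocab_of_cnst (hBmon : IsMonoidOn C₀.ratFnFunctor)
    (hP : T.Prop34Cnst cnst) (A : D)
    (hLine : ∀ (Y : D₀ᵒᵖ) (g : Algebra.GrothendieckGroup (T.ΦR.obj Y)), g ∈ T.cnstR Y →
      ∃ r : T.ΦR.obj Y, g = Algebra.GrothendieckGroup.of r ∨ g = (Algebra.GrothendieckGroup.of r)⁻¹)
    (hInt : ∀ Y : D₀ᵒᵖ, IsCancelMul (T.ΦR.obj Y))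
    (hfin : ∀ f : A ≅ A, IsOfFinOrder (cnst.mapAut _ (C₀.base.mapAut A f))) :
    ∃ Y : PreFrobenioid.Birat (PreFrobenioid.untrFunctor (C₀.isFrobenioid_treeCatVocab_of_isMonoidOn hBmon))
        (PreFrobenioid.isFrobenioid_untr (C₀.isFrobenioid_treeCatVocab_of_isMonoidOn hBmon))
        (PreFrobenioid.hasBiratSquares_untr (C₀.isFrobenioid_treeCatVocab_of_isMonoidOn hBmon)),
      (PreFrobenioid.biratOps
          (PreFrobenioid.isFrobenioid_untr (C₀.isFrobenioid_treeCatVocab_of_isMonoidOn hBmon))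
          (PreFrobenioid.hasBiratSquares_untr (C₀.isFrobenioid_treeCatVocab_of_isMonoidOn hBmon))).IsFrobeniusCompact
        Y :=
  C₀.exists_isFrobeniusCompact_untrBirat_treeCatVocab hBmon A fun f b ξ hb hbξ =>
    C₀.pullGp_cnst_eq_self_of_line_of_cnst hP A hLine hInt f (hfin f) b ξ hb hbξ

/-- **[EtTh] Thm. 3.7 (ii), second clause, at the canonical vocabulary and THE [FrdI] Def. 4.5 parameters,
from typed interface data** ("If, moreover, `Φ` is rational, then `C` is of rationally standard type"): for the
tempered Frobenioid `C`, given `hBmon` ([FrdI] Thm. 5.2 preamble), `D` of FSMFF-type and `Φ` non-dilating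
(first clause), "`Φ` rational" at THE support (`hrat`), Prop. 3.4 (ii) relative to `D^cnst` (`Prop34Cnst`, the
typed hypothesis structure of abc-iut-L2-t3), finiteness of the orders of the images of `Aut_D(A)` in
`Aut_{D^cnst}(A^cnst)` at one object `A` (`hfin`; `Aut(L/K)` is finite), and the constant-line properties
`hLine`, `hInt` of the Def. 3.6 (i) data — with NO automorphism-invariance datum.
[cite: MochizukiEtTh2009, Thm 3.7 (ii) p.79] -/
theorem thm37_ii_ratStd_treeCatVocab_of_cnst (hBmon : IsMonoidOn C₀.ratFnFunctor) (hD : IsOfFSMFFType D)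
    (hnd : IsNonDilatingOn C₀.divisorMonoid)
    (hrat : ∀ X : C₀.category,
      PreFrobenioidData.IsRational
        (PreFrobenioid.biratData (C₀.isFrobenioid_treeCatVocab_of_isMonoidOn hBmon)
          (PreFrobenioid.hasBiratSquares_of_isFrobenioid (C₀.isFrobenioid_treeCatVocab_of_isMonoidOn hBmon)))
        (S := PreFrobenioidData.ofFunctor C₀.divisorMonoid C₀.toElem) (fun a 𝔭 => PrimarySupp a 𝔭) X)
    (hP : T.Prop34Cnst cnst) (A : D)
    (hLine : ∀ (Y : D₀ᵒᵖ) (g : Algebra.GrothendieckGroup (T.ΦR.obj Y)), g ∈ T.cnstR Y →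
      ∃ r : T.ΦR.obj Y, g = Algebra.GrothendieckGroup.of r ∨ g = (Algebra.GrothendieckGroup.of r)⁻¹)
    (hInt : ∀ Y : D₀ᵒᵖ, IsCancelMul (T.ΦR.obj Y))
    (hfin : ∀ f : A ≅ A, IsOfFinOrder (cnst.mapAut _ (C₀.base.mapAut A f))) :
    (PreFrobenioidData.ofFunctor C₀.divisorMonoid C₀.toElem).IsOfRationallyStandardType
      (PreFrobenioid.rsParams (C₀.isFrobenioid_treeCatVocab_of_isMonoidOn hBmon) fun a 𝔭 => PrimarySupp a 𝔭) :=
  C₀.thm37_ii_ratStd_treeCatVocab hBmon hD hnd hrat A fun f b ξ hb hbξ =>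
    C₀.pullGp_cnst_eq_self_of_line_of_cnst hP A hLine hInt f (hfin f) b ξ hb hbξ

/-- **The same with the finiteness hypothesis in its natural global form**: every automorphism group
`Aut_{D^cnst}(Z)` of the constant-field category is a torsion group (print: `D^cnst = B(Spec K)⁰`, all
`Aut(L/K)` finite). [cite: MochizukiEtTh2009, Thm 3.7 (ii) p.79] -/
theorem thm37_ii_ratStd_treeCatVocab_of_cnst' (hBmon : IsMonoidOn C₀.ratFnFunctor) (hD : IsOfFSMFFType D)
    (hnd : IsNonDilatingOn C₀.divisorMonoid)
    (hrat : ∀ X : C₀.category,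
      PreFrobenioidData.IsRational
        (PreFrobenioid.biratData (C₀.isFrobenioid_treeCatVocab_of_isMonoidOn hBmon)
          (PreFrobenioid.hasBiratSquares_of_isFrobenioid (C₀.isFrobenioid_treeCatVocab_of_isMonoidOn hBmon)))
        (S := PreFrobenioidData.ofFunctor C₀.divisorMonoid C₀.toElem) (fun a 𝔭 => PrimarySupp a 𝔭) X)
    (hP : T.Prop34Cnst cnst)
    (hLine : ∀ (Y : D₀ᵒᵖ) (g : Algebra.GrothendieckGroup (T.ΦR.obj Y)), g ∈ T.cnstR Y →
      ∃ r : T.ΦR.obj Y, g = Algebra.GrothendieckGroup.of r ∨ g = (Algebra.GrothendieckGroup.of r)⁻¹)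
    (hInt : ∀ Y : D₀ᵒᵖ, IsCancelMul (T.ΦR.obj Y))
    (hfin : ∀ (Z : Dcnst) (φ : Aut Z), IsOfFinOrder φ) :
    (PreFrobenioidData.ofFunctor C₀.divisorMonoid C₀.toElem).IsOfRationallyStandardType
      (PreFrobenioid.rsParams (C₀.isFrobenioid_treeCatVocab_of_isMonoidOn hBmon) fun a 𝔭 => PrimarySupp a 𝔭) :=
  C₀.thm37_ii_ratStd_treeCatVocab' hBmon hD hnd hrat fun A f b ξ hb hbξ =>
    C₀.pullGp_cnst_eq_self_of_line_of_cnst hP A hLine hInt f (hfin _ _) b ξ hb hbξ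

end TreeVocab

end TemperedFrobenioid

end Literature.AnabelianGeometry.EtaleTheta
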